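import Mathlib
import Literature.AlgebraicGeometry.HyperbolicPolynomials.HyperbolicityCone
import Literature.Combinatorics.StablePolynomials.ElementarySymmetric
import HarnessLib

/-!
# The hyperbolicity cones of the elementary symmetric polynomials (derivative relaxations of the orthant)

Topic `Literature/AlgebraicGeometry/HyperbolicPolynomials`. For `d ≤ n` the elementary symmetric
polynomial `e_d ∈ ℝ[x₁,…,xₙ]` is hyperbolic with respect to `𝟙 = (1,…,1)` and its closed
hyperbolicity cone is Renegar's *derivative relaxation of the orthant*
`ℝ^{n,(n-d)}_+ = Λ₊(e_d, 𝟙) = {x : e₁(x) ≥ 0, …, e_d(x) ≥ 0}`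
(Saunderson–Parrilo, Math. Program. 153 (2015), §1.1 eq. (1) and §1.2 eq. (4); Renegar, Found.
Comput. Math. 6 (2006), §2/§4). This file proves that description and the elementary facts about
these cones used in the semidefinite representations of `SpectrahedralShadowProofs`.

## Main statements (namespace `Literature.AlgebraicGeometry.HyperbolicPolynomials`)

* `esymm_isHomogeneous`, `eval_esymm_eq_sum_powersetCard`, `eval_esymm_const_one`
  (`e_d(𝟙) = C(n, d)`), `isHyperbolic_esymm` (from real stability, tree lemma
  `isRealStable_esymm`, and the tree's `isHyperbolic_of_isRealStable_of_isHomogeneous`).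
* `eval_add_smul_esymm` — the shift expansion
  `e_d(x + t𝟙) = ∑_{m ≤ d} C(n-d+m, n-d) e_{d-m}(x) t^m` (Taylor shift of `∏ᵢ (X + xᵢ)`).
* `mem_hyperbolicityCone_esymm_iff` — **Renegar's description**:
  `x ∈ Λ₊(e_d, 𝟙) ↔ ∀ j ≤ d, 0 ≤ e_j(x)` (`d ≤ n`).
* consequences: permutation invariance (`comp_perm_mem_hyperbolicityCone_esymm_iff`),
  `e₁(x) = 0 ∧ e₂(x) ≥ 0 → x = 0` (`eq_zero_of_esymm_one_eq_zero`), nonnegative vectors lie in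
  every `Λ₊(e_d, 𝟙)`, monotonicity in `d`.

## References

* [SaundersonParrilo2014] J. Saunderson, P. A. Parrilo, Math. Program. 153 (2015) 309–331
  (arXiv:1208.1443): §1.1 eq. (1) (`Λ₊ = {a₁ ≥ 0, …, a_m ≥ 0}`), §1.2 eq. (4)
  (`ℝ^{n,(k)}_+ = Λ₊(e_{n-k}, 𝟙) = {e₁ ≥ 0, …, e_{n-k} ≥ 0}`).
* [Renegar2006] J. Renegar, Found. Comput. Math. 6 (2006) 59–79, §2 and §4 (derivative cones).
-/

noncomputable section

open MvPolynomial
open scoped BigOperators Polynomial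

namespace Literature.AlgebraicGeometry.HyperbolicPolynomials

variable {σ : Type*} [Fintype σ]

/-! ### Elementary facts about `e_d` -/

/-- `e_d` is homogeneous of degree `d`. [folklore] -/
theorem esymm_isHomogeneous (R : Type*) [CommSemiring R] (d : ℕ) :
    (esymm σ R d).IsHomogeneous d := by
  classical
  rw [MvPolynomial.esymm]
  refine IsHomogeneous.sum _ _ _ fun t ht => ?_
  have hcard : t.card = d := (Finset.mem_powersetCard.1 ht).2
  have h := IsHomogeneous.prod t (fun i => (X i : MvPolynomial σ R)) (fun _ => 1)
    fun i _ => isHomogeneous_X R i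
  simpa [hcard] using h

/-- `e_d(x) = ∑_{|S| = d} ∏_{i ∈ S} xᵢ` as a real number. [folklore] -/
theorem eval_esymm_eq_sum_powersetCard {R : Type*} [CommSemiring R] (x : σ → R) (d : ℕ) :
    MvPolynomial.eval x (esymm σ R d) =
      ∑ t ∈ Finset.powersetCard d Finset.univ, ∏ i ∈ t, x i := by
  simp [MvPolynomial.esymm, map_sum, map_prod]

/-- `e_d(𝟙) = C(n, d)`. [folklore] -/
theorem eval_esymm_const_one (R : Type*) [CommSemiring R] (d : ℕ) :
    MvPolynomial.eval (fun _ : σ => (1 : R)) (esymm σ R d) = ((Fintype.card σ).choose d : R) := by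
  rw [eval_esymm_eq_sum_powersetCard]
  simp [Finset.card_powersetCard]

/-- `e_d(x ∘ π) = e_d(x)` for a permutation `π` of the variables (symmetry of `e_d`). [folklore] -/
theorem eval_comp_perm_esymm {R : Type*} [CommSemiring R] (x : σ → R) (π : Equiv.Perm σ)
    (d : ℕ) : MvPolynomial.eval (x ∘ π) (esymm σ R d) = MvPolynomial.eval x (esymm σ R d) := by
  have h := congrArg (MvPolynomial.eval x) (rename_esymm σ R d π)
  rwa [eval_rename] at h

/-- Scaling: `e_d(c • x) = c^d e_d(x)`. [folklore] -/
theorem eval_smul_esymm {R : Type*} [CommSemiring R] (c : R) (x : σ → R) (d : ℕ) :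
    MvPolynomial.eval (c • x) (esymm σ R d) = c ^ d * MvPolynomial.eval x (esymm σ R d) :=
  (esymm_isHomogeneous R d).eval_smul_eq c x

/-- `e₁(x) = ∑ xᵢ`. [folklore] -/
theorem eval_esymm_one_eq_sum {R : Type*} [CommSemiring R] (x : σ → R) :
    MvPolynomial.eval x (esymm σ R 1) = ∑ i, x i := by
  simp [MvPolynomial.esymm_one, map_sum]

omit [Fintype σ] in
/-- `2 ∑_{|t| = 2, t ⊆ s} ∏_{i ∈ t} xᵢ = (∑_{i ∈ s} xᵢ)² - ∑_{i ∈ s} xᵢ²`. [folklore] -/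
theorem two_mul_sum_powersetCard_two (s : Finset σ) (x : σ → ℝ) :
    2 * ∑ t ∈ s.powersetCard 2, ∏ i ∈ t, x i = (∑ i ∈ s, x i) ^ 2 - ∑ i ∈ s, x i ^ 2 := by
  classical
  induction s using Finset.induction_on with
  | empty =>
    rw [Finset.powersetCard_eq_empty.2 (by simp), Finset.sum_empty]
    simp
  | insert a s ha ih =>
    rw [show (2 : ℕ) = 1 + 1 from rfl, Finset.powersetCard_succ_insert ha, Finset.sum_union,
      Finset.sum_image, Finset.sum_insert ha, Finset.sum_insert ha]
    · have h1 : ∑ t ∈ s.powersetCard 1, ∏ i ∈ insert a t, x i = x a * ∑ i ∈ s, x i := by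
        rw [Finset.powersetCard_one, Finset.sum_map, Finset.mul_sum]
        refine Finset.sum_congr rfl fun i hi => ?_
        have hai : a ∉ ({i} : Finset σ) := by
          rw [Finset.mem_singleton]
          rintro rfl
          exact ha hi
        simp [Finset.prod_insert hai]
      rw [h1]
      linear_combination ih
    · intro t₁ ht₁ t₂ ht₂ h
      have ha₁ : a ∉ t₁ := fun h' => ha ((Finset.mem_powersetCard.1 ht₁).1 h')
      have ha₂ : a ∉ t₂ := fun h' => ha ((Finset.mem_powersetCard.1 ht₂).1 h')
      rw [← Finset.erase_insert ha₁, ← Finset.erase_insert ha₂, h]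
    · rw [Finset.disjoint_left]
      intro t ht ht'
      rw [Finset.mem_image] at ht'
      obtain ⟨u, _, rfl⟩ := ht'
      exact ha ((Finset.mem_powersetCard.1 ht).1 (Finset.mem_insert_self a u))

/-- Newton's identity in degree two: `(∑ xᵢ)² = ∑ xᵢ² + 2 e₂(x)`. [folklore] -/
theorem sum_sq_eq_sum_sq_add_two_mul_esymm_two (x : σ → ℝ) :
    (∑ i, x i) ^ 2 = ∑ i, x i ^ 2 + 2 * MvPolynomial.eval x (esymm σ ℝ 2) := by
  rw [eval_esymm_eq_sum_powersetCard, two_mul_sum_powersetCard_two]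
  ring

/-- `e_d` is hyperbolic with respect to `𝟙` for `d ≤ n` (Saunderson–Parrilo §1.2: "each hyperbolic
with respect to `e`", here from the real stability of `e_d`, tree lemma `isRealStable_esymm`).
[cite: SaundersonParrilo2014, §1.2] -/
theorem isHyperbolic_esymm {d : ℕ} (hd : d ≤ Fintype.card σ) :
    IsHyperbolic (esymm σ ℝ d) (fun _ => (1 : ℝ)) :=
  isHyperbolic_of_isRealStable_of_isHomogeneous
    (Literature.Combinatorics.StablePolynomials.isRealStable_esymm hd) (esymm_isHomogeneous ℝ d)
    fun _ => one_pos

/-! ### The shift expansion `e_d(x + t𝟙)` -/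

omit [Fintype σ] in
/-- Taylor shift of a product of linear factors: `τ_r ∏ (X + cᵢ) = ∏ (X + (r + cᵢ))`. [folklore] -/
theorem taylor_prod_X_add_C_eq (s : Finset σ) (c : σ → ℝ) (r : ℝ) :
    Polynomial.taylor r (∏ i ∈ s, (Polynomial.X + Polynomial.C (c i))) =
      ∏ i ∈ s, (Polynomial.X + Polynomial.C (r + c i)) := by
  have h : Polynomial.taylor r (∏ i ∈ s, (Polynomial.X + Polynomial.C (c i))) =
      Polynomial.taylorAlgHom r (∏ i ∈ s, (Polynomial.X + Polynomial.C (c i))) := rfl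
  rw [h, map_prod]
  refine Finset.prod_congr rfl fun i _ => ?_
  change Polynomial.taylor r (Polynomial.X + Polynomial.C (c i)) = _
  rw [map_add, Polynomial.taylor_X, Polynomial.taylor_C, Polynomial.C_add, add_assoc]

/-- The generating polynomial `∏ᵢ (X + xᵢ)` has degree `n`. [folklore] -/
theorem natDegree_prod_X_add_C_eq_card (x : σ → ℝ) :
    (∏ i : σ, (Polynomial.X + Polynomial.C (x i))).natDegree = Fintype.card σ := by
  rw [Polynomial.natDegree_prod_of_monic _ _ fun i _ => Polynomial.monic_X_add_C (x i)]
  simp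

/-- **Shift expansion** of the elementary symmetric polynomials along `𝟙`: for `d ≤ n`,
`e_d(x + t𝟙) = ∑_{m=0}^{d} C(m + (n-d), n-d) · e_{d-m}(x) · t^m`
(Saunderson–Parrilo §3, eq. (14): the coefficients of `t` in the derivatives of
`e_n(x + t𝟙) = ∏ (t + xᵢ)`; here via the Taylor shift of `∏ᵢ (X + xᵢ)`).
[cite: SaundersonParrilo2014, §3 eq. (14)] -/
theorem eval_add_smul_esymm (x : σ → ℝ) (t : ℝ) {d : ℕ} (hd : d ≤ Fintype.card σ) :
    MvPolynomial.eval (x + t • fun _ => (1 : ℝ)) (esymm σ ℝ d) =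
      ∑ m ∈ Finset.range (d + 1), ((m + (Fintype.card σ - d)).choose (Fintype.card σ - d) : ℝ) *
        MvPolynomial.eval x (esymm σ ℝ (d - m)) * t ^ m := by
  classical
  set n := Fintype.card σ with hn
  set g : ℝ[X] := ∏ i : σ, (Polynomial.X + Polynomial.C (x i)) with hg
  have hgdeg : g.natDegree = n := natDegree_prod_X_add_C_eq_card x
  -- the left-hand side is the coefficient of `X^{n-d}` in `∏ (X + (t + xᵢ)) = τ_t g`
  have h1 : MvPolynomial.eval (x + t • fun _ => (1 : ℝ)) (esymm σ ℝ d) =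
      (Polynomial.taylor t g).coeff (n - d) := by
    rw [hg, taylor_prod_X_add_C_eq, Finset.prod_X_add_C_coeff _ _ (by
      rw [Finset.card_univ]; exact Nat.sub_le n d), Finset.card_univ, ← hn,
      Nat.sub_sub_self hd, eval_esymm_eq_sum_powersetCard]
    refine Finset.sum_congr rfl fun s _ => Finset.prod_congr rfl fun i _ => ?_
    simp [add_comm]
  rw [h1, Polynomial.taylor_coeff]
  -- `(hasseDeriv (n-d) g)(t) = ∑_m C(m + (n-d), n-d) g_{m + (n-d)} t^m`
  have hdeg : (Polynomial.hasseDeriv (n - d) g).natDegree < d + 1 := by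
    refine lt_of_le_of_lt (Polynomial.natDegree_hasseDeriv_le g (n - d)) ?_
    rw [hgdeg]
    omega
  rw [Polynomial.eval_eq_sum_range' hdeg]
  refine Finset.sum_congr rfl fun m hm => ?_
  rw [Finset.mem_range] at hm
  rw [Polynomial.hasseDeriv_coeff, hg, Finset.prod_X_add_C_coeff _ _ (by
    rw [Finset.card_univ]; omega), Finset.card_univ, ← hn, eval_esymm_eq_sum_powersetCard,
    show n - (m + (n - d)) = d - m by omega]

/-! ### Renegar's description of `Λ₊(e_d, 𝟙)` -/

/-- Nonnegative entries have nonnegative elementary symmetric means. [folklore] -/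
theorem eval_esymm_nonneg_of_nonneg {x : σ → ℝ} (hx : ∀ i, 0 ≤ x i) (d : ℕ) :
    0 ≤ MvPolynomial.eval x (esymm σ ℝ d) := by
  rw [eval_esymm_eq_sum_powersetCard]
  exact Finset.sum_nonneg fun t _ => Finset.prod_nonneg fun i _ => hx i

/-- `esymm` of a multiset of nonnegative reals is nonnegative. [folklore] -/
theorem multiset_esymm_nonneg {s : Multiset ℝ} (hs : ∀ a ∈ s, 0 ≤ a) (j : ℕ) :
    0 ≤ s.esymm j := by
  rw [Multiset.esymm]
  refine Multiset.sum_nonneg fun b hb => ?_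
  rw [Multiset.mem_map] at hb
  obtain ⟨u, hu, rfl⟩ := hb
  refine Multiset.prod_nonneg fun a ha => hs a ?_
  exact Multiset.mem_of_le (Multiset.mem_powersetCard.1 hu).1 ha

/-- **Renegar's description of the derivative relaxations of the orthant**
(Saunderson–Parrilo 2015, §1.2 eq. (4), from Renegar 2006 eq. (1)): for `d ≤ n`,
`Λ₊(e_d, 𝟙) = {x ∈ ℝⁿ : e₁(x) ≥ 0, e₂(x) ≥ 0, …, e_d(x) ≥ 0}`.
Proof: `e_d(x + t𝟙) = e_d(𝟙) ∏ᵢ (t + λᵢ(x))` with all `λᵢ(x) ≥ 0` exactly on `Λ₊`; comparing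
with the shift expansion gives `C(n-j, d-j) e_j(x) = C(n, d) e_j(λ(x)) ≥ 0`; conversely
nonnegative `e_j(x)` make `e_d(x + t𝟙) ≥ C(n,d) t^d > 0` for `t > 0`.
[cite: SaundersonParrilo2014, §1.2 eq. (4)] -/
theorem mem_hyperbolicityCone_esymm_iff {d : ℕ} (hd : d ≤ Fintype.card σ) (x : σ → ℝ) :
    x ∈ hyperbolicityCone (esymm σ ℝ d) (fun _ => (1 : ℝ)) ↔
      ∀ j ≤ d, 0 ≤ MvPolynomial.eval x (esymm σ ℝ j) := by
  classical
  constructor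
  · intro hx j hj
    -- compare the two expansions of `t ↦ e_d(x + t𝟙)` as polynomials
    have hhyp := isHyperbolic_esymm (σ := σ) hd
    have hhom := esymm_isHomogeneous (σ := σ) ℝ d
    set lam := eigenvalues (esymm σ ℝ d) (fun _ => (1 : ℝ)) x with hlam
    have hnn : ∀ a ∈ lam, 0 ≤ a := (mem_hyperbolicityCone_iff_eigenvalues_nonneg hhom hhyp x).1 hx
    have hcard : Multiset.card lam = d := card_eigenvalues hhom hhyp x
    set P : ℝ[X] := ∑ m ∈ Finset.range (d + 1),
      Polynomial.C (((m + (Fintype.card σ - d)).choose (Fintype.card σ - d) : ℝ) * MvPolynomial.eval x (esymm σ ℝ (d - m))) *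
        Polynomial.X ^ m with hP
    set Q : ℝ[X] := Polynomial.C (((Fintype.card σ).choose d : ℝ)) *
      (lam.map fun a => Polynomial.X + Polynomial.C a).prod with hQ
    have hPQ : P = Q := by
      apply Polynomial.funext
      intro t
      have h1 : P.eval t = MvPolynomial.eval (x + t • fun _ => (1 : ℝ)) (esymm σ ℝ d) := by
        rw [eval_add_smul_esymm x t hd, hP, Polynomial.eval_finsetSum]
        refine Finset.sum_congr rfl fun m _ => ?_
        simp [Polynomial.eval_pow]
      have h2 : Q.eval t = MvPolynomial.eval (x + t • fun _ => (1 : ℝ)) (esymm σ ℝ d) := by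
        rw [eval_add_smul_eq_eval_mul_prod_eigenvalues hhom hhyp x t, eval_esymm_const_one, hQ,
          Polynomial.eval_mul, Polynomial.eval_C, Polynomial.eval_multiset_prod, Multiset.map_map]
        congr 1
        refine congrArg Multiset.prod (Multiset.map_congr rfl fun a _ => ?_)
        simp
      rw [h1, h2]
    -- read off the coefficient of `X^{d-j}`
    have hcoef := congrArg (fun p : ℝ[X] => p.coeff (d - j)) hPQ
    simp only [hP, hQ] at hcoef
    rw [Polynomial.finsetSum_coeff, Finset.sum_eq_single (d - j), Polynomial.coeff_C_mul,
      Polynomial.coeff_X_pow, if_pos rfl, mul_one, Polynomial.coeff_C_mul,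
      Multiset.prod_X_add_C_coeff _ (by rw [hcard]; omega), hcard,
      Nat.sub_sub_self hj] at hcoef
    · -- `C(n - j, n - d) e_j(x) = C(n,d) e_j(λ) ≥ 0`
      have hpos : (0 : ℝ) < ((d - j + (Fintype.card σ - d)).choose (Fintype.card σ - d) : ℝ) := by
        exact_mod_cast Nat.choose_pos (by omega)
      have hrhs : 0 ≤ ((Fintype.card σ).choose d : ℝ) * lam.esymm j :=
        mul_nonneg (Nat.cast_nonneg _) (multiset_esymm_nonneg hnn j)
      rw [← hcoef] at hrhs
      exact nonneg_of_mul_nonneg_right hrhs hpos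
    · intro m _ hm
      rw [Polynomial.coeff_C_mul, Polynomial.coeff_X_pow, if_neg (Ne.symm hm), mul_zero]
    · intro h
      exfalso
      exact h (Finset.mem_range.2 (by omega))
  · intro h τ hτ
    rw [eval_add_smul_esymm x τ hd]
    -- every term is nonnegative and the top term is `C(n,d) τ^d > 0`
    have hterm : ∀ m ∈ Finset.range (d + 1), 0 ≤ ((m + (Fintype.card σ - d)).choose (Fintype.card σ - d) : ℝ) *
        MvPolynomial.eval x (esymm σ ℝ (d - m)) * τ ^ m := fun m _ =>
      mul_nonneg (mul_nonneg (Nat.cast_nonneg _) (h _ (Nat.sub_le d m))) (pow_nonneg hτ.le m)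
    have htop : 0 < ((d + (Fintype.card σ - d)).choose (Fintype.card σ - d) : ℝ) *
        MvPolynomial.eval x (esymm σ ℝ (d - d)) * τ ^ d := by
      rw [Nat.sub_self, MvPolynomial.esymm_zero, map_one, mul_one]
      exact mul_pos (by exact_mod_cast Nat.choose_pos (by omega)) (pow_pos hτ d)
    have hle := Finset.single_le_sum hterm (Finset.mem_range.2 (Nat.lt_succ_self d))
    exact (lt_of_lt_of_le htop hle).ne'

/-- The degenerate case `d = 0`: `e₀ = 1` and `Λ₊(1, 𝟙) = ℝⁿ`. [folklore] -/
theorem hyperbolicityCone_esymm_zero :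
    hyperbolicityCone (esymm σ ℝ 0) (fun _ => (1 : ℝ)) = Set.univ := by
  ext x
  simp [mem_hyperbolicityCone_iff, MvPolynomial.esymm_zero]

/-! ### Consequences -/

/-- **Permutation invariance** (Saunderson–Parrilo §1.2, "Symmetry"): `Λ₊(e_d, 𝟙)` is invariant
under permutations of the coordinates. [cite: SaundersonParrilo2014, §1.2 (Symmetry)] -/
theorem comp_perm_mem_hyperbolicityCone_esymm_iff (d : ℕ) (x : σ → ℝ) (π : Equiv.Perm σ) :
    x ∘ π ∈ hyperbolicityCone (esymm σ ℝ d) (fun _ => (1 : ℝ)) ↔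
      x ∈ hyperbolicityCone (esymm σ ℝ d) (fun _ => (1 : ℝ)) := by
  simp only [mem_hyperbolicityCone_iff]
  refine forall_congr' fun τ => imp_congr_right fun _ => ?_
  have : (x ∘ π + τ • fun _ => (1 : ℝ)) = (x + τ • fun _ => (1 : ℝ)) ∘ π := by
    funext i; simp
  rw [this, eval_comp_perm_esymm]

/-- **Cone property**: `Λ₊(e_d, 𝟙)` is closed under nonnegative scaling. [folklore] -/
theorem smul_mem_hyperbolicityCone_esymm {d : ℕ} (hd : d ≤ Fintype.card σ) {x : σ → ℝ}
    (hx : x ∈ hyperbolicityCone (esymm σ ℝ d) (fun _ => (1 : ℝ))) {c : ℝ} (hc : 0 ≤ c) :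
    c • x ∈ hyperbolicityCone (esymm σ ℝ d) (fun _ => (1 : ℝ)) := by
  rw [mem_hyperbolicityCone_esymm_iff hd] at hx ⊢
  intro j hj
  rw [eval_smul_esymm]
  exact mul_nonneg (pow_nonneg hc j) (hx j hj)

/-- `0 ∈ Λ₊(e_d, 𝟙)`. [folklore] -/
theorem zero_mem_hyperbolicityCone_esymm {d : ℕ} (hd : d ≤ Fintype.card σ) :
    (0 : σ → ℝ) ∈ hyperbolicityCone (esymm σ ℝ d) (fun _ => (1 : ℝ)) := by
  have h := smul_mem_hyperbolicityCone_esymm hd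
    (self_mem_hyperbolicityCone (esymm_isHomogeneous ℝ d) (isHyperbolic_esymm hd).eval_ne_zero)
    le_rfl
  rwa [zero_smul] at h

/-- **Outer approximation of the orthant**: nonnegative vectors lie in every `Λ₊(e_d, 𝟙)`
(Saunderson–Parrilo §1.2: `Λ₊ ⊆ Λ₊^{(1)} ⊆ ⋯`). [cite: SaundersonParrilo2014, §1.2] -/
theorem mem_hyperbolicityCone_esymm_of_nonneg {d : ℕ} (hd : d ≤ Fintype.card σ) {x : σ → ℝ}
    (hx : ∀ i, 0 ≤ x i) : x ∈ hyperbolicityCone (esymm σ ℝ d) (fun _ => (1 : ℝ)) := by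
  rw [mem_hyperbolicityCone_esymm_iff hd]
  exact fun j _ => eval_esymm_nonneg_of_nonneg hx j

/-- **Monotonicity in the degree**: `Λ₊(e_d, 𝟙) ⊆ Λ₊(e_{d'}, 𝟙)` for `d' ≤ d ≤ n` (the chain of
derivative relaxations, Saunderson–Parrilo §1.2). [cite: SaundersonParrilo2014, §1.2] -/
theorem hyperbolicityCone_esymm_mono {d d' : ℕ} (hd' : d' ≤ d) (hd : d ≤ Fintype.card σ) :
    hyperbolicityCone (esymm σ ℝ d) (fun _ => (1 : ℝ)) ⊆
      hyperbolicityCone (esymm σ ℝ d') (fun _ => (1 : ℝ)) := by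
  intro x hx
  rw [mem_hyperbolicityCone_esymm_iff hd] at hx
  rw [mem_hyperbolicityCone_esymm_iff (hd'.trans hd)]
  exact fun j hj => hx j (hj.trans hd')

/-- The top case `d = n`: `Λ₊(e_n, 𝟙)` is the nonnegative orthant (`e_n = ∏ xᵢ`; tree lemma
`hyperbolicityCone_prod_X`). [cite: SaundersonParrilo2014, §1.1] -/
theorem hyperbolicityCone_esymm_card :
    hyperbolicityCone (esymm σ ℝ (Fintype.card σ)) (fun _ => (1 : ℝ)) = {x | ∀ i, 0 ≤ x i} := by
  classical
  have h : esymm σ ℝ (Fintype.card σ) = ∏ i, X i := by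
    rw [MvPolynomial.esymm, ← Finset.card_univ, Finset.powersetCard_self, Finset.sum_singleton]
  rw [h]
  exact hyperbolicityCone_prod_X

/-- On `Λ₊(e_d, 𝟙)` with `1 ≤ d ≤ n` the coordinate sum is nonnegative: `e₁(x) = ∑ xᵢ ≥ 0`.
[cite: SaundersonParrilo2014, §1.2 eq. (4)] -/
theorem sum_nonneg_of_mem_hyperbolicityCone_esymm {d : ℕ} (hd1 : 1 ≤ d) (hd : d ≤ Fintype.card σ)
    {x : σ → ℝ} (hx : x ∈ hyperbolicityCone (esymm σ ℝ d) (fun _ => (1 : ℝ))) : 0 ≤ ∑ i, x i := by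
  rw [← eval_esymm_one_eq_sum]
  exact (mem_hyperbolicityCone_esymm_iff hd x).1 hx 1 hd1

/-- If `∑ xᵢ = 0` and `e₂(x) ≥ 0` then `x = 0` (`∑ xᵢ² = (∑ xᵢ)² - 2e₂(x) ≤ 0`); this is the
step "`ℝ^{n,(k)}_+ ∩ {e₁ = 0} = {0}` for `k ≤ n - 2`" in the proof of Saunderson–Parrilo Prop. 3.
[cite: SaundersonParrilo2014, proof of Prop. 3] -/
theorem eq_zero_of_esymm_one_eq_zero {x : σ → ℝ} (h1 : ∑ i, x i = 0)
    (h2 : 0 ≤ MvPolynomial.eval x (esymm σ ℝ 2)) : x = 0 := by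
  have hsq := sum_sq_eq_sum_sq_add_two_mul_esymm_two x
  rw [h1] at hsq
  have hle : ∑ i, x i ^ 2 ≤ 0 := by nlinarith
  have hzero : ∀ i ∈ (Finset.univ : Finset σ), x i ^ 2 = 0 :=
    (Finset.sum_eq_zero_iff_of_nonneg fun i _ => sq_nonneg (x i)).1
      (le_antisymm hle (Finset.sum_nonneg fun i _ => sq_nonneg (x i)))
  funext i
  exact pow_eq_zero_iff (n := 2) two_ne_zero |>.1 (hzero i (Finset.mem_univ i))

/-- On `Λ₊(e_d, 𝟙)` with `2 ≤ d ≤ n`, `∑ xᵢ = 0` forces `x = 0`.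
[cite: SaundersonParrilo2014, proof of Prop. 3] -/
theorem eq_zero_of_mem_hyperbolicityCone_esymm_of_sum_eq_zero {d : ℕ} (hd2 : 2 ≤ d)
    (hd : d ≤ Fintype.card σ) {x : σ → ℝ}
    (hx : x ∈ hyperbolicityCone (esymm σ ℝ d) (fun _ => (1 : ℝ))) (h0 : ∑ i, x i = 0) : x = 0 :=
  eq_zero_of_esymm_one_eq_zero h0 ((mem_hyperbolicityCone_esymm_iff hd x).1 hx 2 hd2)

/-- The case `d = 1`: `Λ₊(e₁, 𝟙)` is the closed half-space `{x | ∑ xᵢ ≥ 0}` (Saunderson–Parrilo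
§1.2: "The last of these … is simply the closed half-space defined by `e`").
[cite: SaundersonParrilo2014, §1.2] -/
theorem mem_hyperbolicityCone_esymm_one_iff (h1 : 1 ≤ Fintype.card σ) (x : σ → ℝ) :
    x ∈ hyperbolicityCone (esymm σ ℝ 1) (fun _ => (1 : ℝ)) ↔ 0 ≤ ∑ i, x i := by
  rw [mem_hyperbolicityCone_esymm_iff h1, ← eval_esymm_one_eq_sum]
  constructor
  · exact fun h => h 1 le_rfl
  · intro h j hj
    rcases Nat.le_one_iff_eq_zero_or_eq_one.1 hj with rfl | rfl
    · simp [MvPolynomial.esymm_zero]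
    · exact h

end Literature.AlgebraicGeometry.HyperbolicPolynomials

end
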